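import Summits.FinalStateConjecture.FinalStateConjecture.Theses.ExactKerrEnds
import Summits.FinalStateConjecture.FinalStateConjecture.Theorems.ExactKerrEndsCensorshipAlongKerrEndsNonposMassCensored
import HarnessLib

/-!
# Route ExactKerrEnds — crux `AdmissibleMassNonneg` (stmt-FinalStateConjecture-18051):
# conditional closure from the named fact `positive_mass_theorem_spacetime`

The crux (#6 of the route, binder `hP` of the deciding theorem `closes` since rev 5) is the POSITIVE
MASS THEOREM ON THE ADMISSIBLE VACUUM CLASS: for every admissible vacuum datum `d` on `X`, every sole
end `e` of `X` and every `M` with `h = (1 + 2M/r) δ + o₂(r⁻¹)`, `k = o₁(r⁻²)` on `e`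
(`AFEnd.IsStronglyAsymptoticallyFlatDR d M`), `0 ≤ M`.

It is the vacuum, `P_ADM = 0` special case of the spacetime positive mass theorem `|P| ≤ E`
(Schoen–Yau 1981, Witten 1981; Eichmair–Huang–Lee–Schoen 2016, Thm. 1), which the tree holds as the
undischarged NAMED FACT `Literature.Geometry.Lorentzian.positive_mass_theorem_spacetime`
(`MassInequalities.lean`). This file records the conditional closure of the item from that fact —
the pattern of `mghdExistence_of_choquetBruhatGeroch` for the shared crux `MGHDExists` — by the landed
bookkeeping `CensorshipAlongKerrEnds.massParam_nonneg_of_pmt` (admissible data satisfy the dominant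
energy condition with decaying sources, are complete and asymptotically flat of order `1`, their ADM
energy flux converges to the DR mass parameter and their ADM momentum fluxes to `0`, so `0 ≤ |P| ≤ E = M`).
The item itself stays open until the fact is discharged (`positive_mass_theorem_spacetime_holds`).

References: Eichmair–Huang–Lee–Schoen, JEMS 18 (2016), Thm. 1; Schoen–Yau, CMP 79 (1981);
Witten, CMP 80 (1981); Dafermos–Rodnianski, arXiv:0811.0354, App. B.2.3 (the DR decay class).
-/

-- the doubled `FinalStateConjecture.FinalStateConjecture` path component trips dupNamespace
set_option linter.dupNamespace false

noncomputable section

open scoped Manifold ContDiff Topology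

namespace Summit.FinalStateConjecture.FinalStateConjecture.Theorems.ExactKerrEnds

open Literature.Geometry.Lorentzian
open Summit.FinalStateConjecture.FinalStateConjecture.Theses.ExactKerrEnds (AdmissibleMassNonneg)

/-- **The crux `AdmissibleMassNonneg` follows from the spacetime positive mass theorem**
(conditional closure of item stmt-FinalStateConjecture-18051 from the named fact
`positive_mass_theorem_spacetime`, Eichmair–Huang–Lee–Schoen 2016, Thm. 1): for an admissible datum
which is DR-flat with mass parameter `M` on a sole end, `|P| ≤ E` reads `0 ≤ M`
(`CensorshipAlongKerrEnds.massParam_nonneg_of_pmt`).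
[cite: EichmairHuangLeeSchoen2016, Thm. 1] [cite: DafermosRodnianski2013, App. B.2.3] -/
theorem admissibleMassNonneg_of_pmt (hpmt : positive_mass_theorem_spacetime) :
    AdmissibleMassNonneg := by
  intro X _ _ _ _ _ _ d hd e M hsole hDR
  exact CensorshipAlongKerrEnds.massParam_nonneg_of_pmt hpmt hd hsole hDR

/-- **Conversely, on the admissible vacuum class the crux IS the positive mass theorem in its
`E ≥ |P|` form**: for an admissible datum, DR-flat with parameter `M` on a sole end, the ADM energy is
`M` and the ADM momentum vanishes (`IsStronglyAsymptoticallyFlatDR.admEnergy_eq`,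
`…admMomentum_eq_zero`), so `AdmissibleMassNonneg` gives `|P| = 0 ≤ M = E` — the conclusion of
`positive_mass_theorem_spacetime` for these data, with no fact assumed.
[cite: DafermosRodnianski2013, App. B.2.3] -/
theorem sqrt_sum_admMomentum_sq_le_admEnergy_of_admissibleMassNonneg (hP : AdmissibleMassNonneg)
    {X : Type} [TopologicalSpace X] [ChartedSpace E3 X] [IsManifold (𝓡 3) ∞ X] [T2Space X]
    [SecondCountableTopology X] [ConnectedSpace X] {d : InitialDataSet (𝓡 3) X}
    (hd : d ∈ admissibleVacuumData X) {e : AFEnd X} {M : ℝ} (hsole : e.IsSoleEnd)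
    (hDR : e.IsStronglyAsymptoticallyFlatDR d M) :
    Real.sqrt (∑ i : Fin 3, e.admMomentum d i ^ 2) ≤ e.admEnergy d := by
  have hM : 0 ≤ M := hP X d hd e M hsole hDR
  have hP0 : ∀ i : Fin 3, e.admMomentum d i = 0 := fun i ↦ hDR.admMomentum_eq_zero i
  simp only [hP0, ne_eq, OfNat.ofNat_ne_zero, not_false_eq_true, zero_pow, Finset.sum_const_zero,
    Real.sqrt_zero]
  rw [hDR.admEnergy_eq]
  exact hM

end Summit.FinalStateConjecture.FinalStateConjecture.Theorems.ExactKerrEnds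

end
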